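import Literature.Combinatorics.Optimization.ShellLawLevelStep
import Mathlib.Algebra.Group.ForwardDiff
import HarnessLib

/-!
# Level smoothness of a shell law is `x`-smoothness of deleted shell laws: the iterated `ℓ¹` bound

Continuation of `ShellLawLevelStep.lean` (§7 `levelStep_shellLaw`, §8 its `ℓ¹` form). Fix a perfect
matching (`π` its partner involution), a `π`-stable ground set `S`, a block `H`. The shell law of the
block statistic `X = |U ∩ H|` at cut size `T` and level `c` is `law_S(T,c;x)` (`shellLaw`). ONE level
step is one second `x`-difference of the signed two-edge-deletion sum (`levelStep_shellLaw`):
`law_S(t+2,c+2;·) − law_S(t+2,c;·) = −(1/(|S|(|S|−2)))·∇²[Σ_{AD} law_{S∖2e}(t,c;·) − Σ_{BB′} law_{S∖2e}(t,c;·)]`.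
Iterating `k` times and giving away the `AD/BB′` sign cancellation (triangle inequality at each step)
yields THE ITERATED `ℓ¹` BOUND (`sum_abs_nab2_iter_fwdDiff_iter_le`): over any finite window `X ⊆ ℤ`,

  `Σ_{x∈X} |∇^{2j} Δ^k_{(2)} law_S(t+2k, ·; x)(c)| ≤ ρ^k · B`

whenever every `k`-fold two-edge-deleted sub-ground-set `S′` (`|S′| = |S| − 4k`) has
`Σ_{x∈X} |∇^{2(j+k)} law_{S′}(t, c; x)| ≤ B`, and every intermediate ground set `S′` has at most
`ρ·|S′|(|S′|−2)` deletion pairs (`|AA||DD| + |BH||BN| ≤ ρ|S′|(|S′|−2)`). Here `Δ_{(2)}` is the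
forward difference of step `2` in the level (Mathlib `fwdDiff 2` on profiles `ℕ → ℤ → ℝ`) and `∇²`
the second backward difference in `x` (`ShellStep.nab2`).

So the LEVEL smoothness of a block-statistic shell profile — the quantity an exact extrapolation
design prices (cell pnp-psdrank, `ExactDesignRemainder`, prover bricks 110–116, MEMO-23 §7 (S_k)) — is
reduced to the `x`-SMOOTHNESS `‖∇^{2k} law_{S′}‖_{ℓ¹}` of fixed-level shell laws of sub-matchings, for
which `ShellLawLevelStep` §9–§10 (mixture of shifted hypergeometric laws) and
`Probability/Distributions/PoissonBinomial{Smoothness,Differences}` (Röllin–Ross calculus) give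
`(Ck/V)^k`. Also here: nonemptiness of shells propagates down the levels and to deleted ground sets
(`shellIn_nonempty_of_le`, `shellIn_del2_nonempty`).

All PROVED, 0 sorry, no named facts; bookkeeping on Rothvoß's slack-matrix combinatorics
[Rothvoß 2017, §2] with the `ℓ¹`-smoothness functional of [Röllin–Ross 2015, §3].

## References
* [Rothvoss2017] T. Rothvoß, *The matching polytope has exponential extension complexity*, J. ACM 64
  (2017), §2 (PDF pp. 5–6).
* [RollinRoss2010] A. Röllin, N. Ross, *Local limit theorems via Landau–Kolmogorov inequalities*,
  Bernoulli 21 (2015), §3 (the smoothness measures `D_n`, Lemma 3.1).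
-/

noncomputable section

open Finset

namespace Literature.Combinatorics.Optimization

namespace ShellStep

variable {n : ℕ} {π : Fin n → Fin n}

/-! ### §1 Operator bookkeeping: `∇²` in `x` commutes with `Δ_{(2)}` in the level -/

/-- `∇²` (in `x`) commutes with the level difference `Δ_{(2)}`. [cite: Rothvoss2017, §2 (PDF p. 6)] -/
theorem nab2_fwdDiff (P : Profile) : nab2 (fwdDiff 2 P) = fwdDiff 2 (nab2 P) := by
  funext c x
  simp only [nab2, fwdDiff, Pi.sub_apply]
  ring

/-- Iterated form: `(∇²)^j Δ^k_{(2)} = Δ^k_{(2)} (∇²)^j`. [cite: Rothvoss2017, §2 (PDF p. 6)] -/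
theorem nab2_iter_fwdDiff_iter (j k : ℕ) (P : Profile) :
    nab2^[j] ((fwdDiff 2)^[k] P) = (fwdDiff 2)^[k] (nab2^[j] P) := by
  have hc : Function.Commute nab2 (fwdDiff (2 : ℕ) : Profile → Profile) := fun P => nab2_fwdDiff P
  exact (hc.iterate_iterate j k).eq P

/-- `(∇²)^j P` at level `c` depends only on `P` at level `c`. [cite: Rothvoss2017, §2 (PDF p. 6)] -/
theorem nab2_iter_apply_congr (j : ℕ) {P Q : Profile} {c : ℕ} (h : P c = Q c) :
    nab2^[j] P c = nab2^[j] Q c := by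
  induction j generalizing P Q with
  | zero => simpa using h
  | succ j ih =>
      rw [Function.iterate_succ_apply, Function.iterate_succ_apply]
      refine ih ?_
      funext x
      simp only [nab2]
      rw [h]

/-- `Δ^k_{(2)} P` at level `c` depends only on `P` at the levels `c + 2i`, `i ≤ k`.
[cite: Rothvoss2017, §2 (PDF p. 6)] -/
theorem fwdDiff_iter_apply_congr (k : ℕ) {P Q : Profile} {c : ℕ}
    (h : ∀ i, i ≤ k → P (c + 2 * i) = Q (c + 2 * i)) :
    (fwdDiff 2)^[k] P c = (fwdDiff 2)^[k] Q c := by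
  rw [fwdDiff_iter_eq_sum_shift, fwdDiff_iter_eq_sum_shift]
  refine sum_congr rfl fun i hi => ?_
  rw [show c + i • 2 = c + 2 * i by rw [smul_eq_mul]; ring, h i (Nat.lt_succ_iff.1 (mem_range.1 hi))]

/-- `Δ^k_{(2)}` is additive: differences. [cite: Rothvoss2017, §2 (PDF p. 6)] -/
theorem fwdDiff_iter_sub' (k : ℕ) (P Q : Profile) :
    (fwdDiff 2)^[k] (P - Q) = (fwdDiff 2)^[k] P - (fwdDiff 2)^[k] Q := by
  induction k generalizing P Q with
  | zero => rfl
  | succ k ih =>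
      rw [Function.iterate_succ_apply, Function.iterate_succ_apply, Function.iterate_succ_apply, ← ih]
      congr 1
      funext c x
      simp only [fwdDiff, Pi.sub_apply]
      ring

/-- `Δ^k_{(2)}` is additive: finite sums. [cite: Rothvoss2017, §2 (PDF p. 6)] -/
theorem fwdDiff_iter_sum' {ι : Type*} (k : ℕ) (s : Finset ι) (P : ι → Profile) :
    (fwdDiff 2)^[k] (∑ i ∈ s, P i) = ∑ i ∈ s, (fwdDiff 2)^[k] (P i) := by
  induction k generalizing P with
  | zero => rfl
  | succ k ih =>
      rw [Function.iterate_succ_apply]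
      have h1 : fwdDiff 2 (∑ i ∈ s, P i) = ∑ i ∈ s, fwdDiff 2 (P i) := by
        funext c x
        simp only [fwdDiff, Finset.sum_apply, Pi.sub_apply, sum_sub_distrib]
      rw [h1, ih]
      rfl

/-- `Δ^k_{(2)}` commutes with scalars. [cite: Rothvoss2017, §2 (PDF p. 6)] -/
theorem fwdDiff_iter_smul' (k : ℕ) (r : ℝ) (P : Profile) :
    (fwdDiff 2)^[k] (r • P) = r • (fwdDiff 2)^[k] P := by
  induction k generalizing P with
  | zero => rfl
  | succ k ih =>
      rw [Function.iterate_succ_apply, Function.iterate_succ_apply, ← ih]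
      congr 1
      funext c x
      simp only [fwdDiff, Pi.smul_apply, Pi.sub_apply, smul_eq_mul]
      ring

/-! ### §2 Nonemptiness of shells propagates down the levels and to deleted ground sets -/

section Nonempty

variable (hπ : ∀ v, π (π v) = v) (hπ' : ∀ v, π v ≠ v)
include hπ hπ'

/-- Two levels down: `Shell_S(T,c+2) ≠ ∅ ⇒ Shell_S(T,c) ≠ ∅` (un-move a half vertex onto the partner
of another). [cite: Rothvoss2017, §2 (PDF p. 6)] -/
theorem shellIn_nonempty_down {S : Finset (Fin n)} (hS : ∀ v ∈ S, π v ∈ S) {T c : ℕ}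
    (h : (shellIn π S T (c + 2)).Nonempty) : (shellIn π S T c).Nonempty := by
  obtain ⟨U', hU'⟩ := h
  have hcard : (half π U').card = c + 2 := (mem_shellIn.1 hU').2.2
  obtain ⟨a, ha, b, hb, hab⟩ := one_lt_card.1 (by rw [hcard]; omega)
  exact ⟨_, unmove_mem_shellIn hπ hπ' hS hU' ha hb hab⟩

/-- `2k` levels down: `Shell_S(T,c+2k) ≠ ∅ ⇒ Shell_S(T,c) ≠ ∅`. [cite: Rothvoss2017, §2 (PDF p. 6)] -/
theorem shellIn_nonempty_of_le {S : Finset (Fin n)} (hS : ∀ v ∈ S, π v ∈ S) {T c : ℕ} (k : ℕ)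
    (h : (shellIn π S T (c + 2 * k)).Nonempty) : (shellIn π S T c).Nonempty := by
  induction k generalizing c with
  | zero => simpa using h
  | succ k ih =>
      refine ih ?_
      apply shellIn_nonempty_down hπ hπ' hS
      rw [show c + 2 * k + 2 = c + 2 * (k + 1) by ring]
      exact h

/-- Nonemptiness passes to a two-edge-deleted ground set, two levels down in the top level:
`Shell_S(t+2,c+2) ≠ ∅ ⇒ Shell_{S∖{v,πv,w,πw}}(t,c) ≠ ∅` for distinct edges at `v`, `w`
(the two-edge size ratio `card_shellIn_del2_ratio`). [cite: Rothvoss2017, §2 (PDF p. 6)] -/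
theorem shellIn_del2_nonempty {S : Finset (Fin n)} (hS : ∀ v ∈ S, π v ∈ S) {t c : ℕ}
    (hne : (shellIn π S (t + 2) (c + 2)).Nonempty) {v w : Fin n} (hv : v ∈ S) (hw : w ∈ S)
    (hwv : w ≠ v) (hwπ : w ≠ π v) : (shellIn π (del2 π S v w) t c).Nonempty := by
  have hr := card_shellIn_del2_ratio hπ hπ' hS hv hw hwv hwπ t c
  obtain ⟨U', hU'⟩ := hne
  have h1 : c + 2 ≤ t + 2 := le_of_mem_shellIn hU'
  have h2 : t + 2 + (c + 2) ≤ S.card := add_le_of_mem_shellIn hπ hS hU'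
  have hdown : (shellIn π S (t + 2) c).Nonempty := shellIn_nonempty_down hπ hπ' hS ⟨U', hU'⟩
  have hpos : 0 < ((t : ℝ) + 2 - c) * ((S.card : ℝ) - (t + 2) - c) * (shellIn π S (t + 2) c).card := by
    have hc1 : (0 : ℝ) < (t : ℝ) + 2 - c := by
      have : (c : ℝ) + 2 ≤ (t : ℝ) + 2 := by exact_mod_cast h1
      linarith
    have hc2 : (0 : ℝ) < (S.card : ℝ) - (t + 2) - c := by
      have : ((t + 2 + (c + 2) : ℕ) : ℝ) ≤ S.card := by exact_mod_cast h2
      push_cast at this; linarith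
    have hc3 : (0 : ℝ) < (shellIn π S (t + 2) c).card := by exact_mod_cast hdown.card_pos
    positivity
  rw [← hr] at hpos
  have : 0 < ((shellIn π (del2 π S v w) t c).card : ℝ) := by
    by_contra h0
    rw [not_lt] at h0
    have h0' : ((shellIn π (del2 π S v w) t c).card : ℝ) = 0 := le_antisymm h0 (Nat.cast_nonneg _)
    rw [h0', mul_zero] at hpos
    exact lt_irrefl _ hpos
  exact card_pos.1 (by exact_mod_cast this)

end Nonempty

/-! ### §3 The iterated `ℓ¹` bound -/

section Iterated

variable (hπ : ∀ v, π (π v) = v) (hπ' : ∀ v, π v ≠ v)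
include hπ hπ'

/-- One level step as an identity of PROFILES on an initial segment of levels: for `i ≤ k` (with
`Shell_S(t+2,c+2k+2) ≠ ∅`), `Δ_{(2)}[law_S(t+2,·)](c+2i) = −(1/(|S|(|S|−2)))·∇²[delStepLaw_S(t,·)](c+2i)`.
[cite: Rothvoss2017, §2 (PDF p. 6)] -/
theorem fwdDiff_shellLaw_eq {S : Finset (Fin n)} (hS : ∀ v ∈ S, π v ∈ S) (H : Finset (Fin n))
    (t c k : ℕ) (hne : (shellIn π S (t + 2) (c + 2 * k + 2)).Nonempty) (i : ℕ) (hi : i ≤ k) :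
    fwdDiff 2 (fun c' x => shellLaw π S H (t + 2) c' x : Profile) (c + 2 * i) =
      (-(1 / ((S.card : ℝ) * ((S.card : ℝ) - 2))) • nab2 (fun c' x => delStepLaw π S H t c' x : Profile)) (c + 2 * i) := by
  have hne' : (shellIn π S (t + 2) (c + 2 * i + 2)).Nonempty := by
    refine shellIn_nonempty_of_le hπ hπ' hS (k - i) ?_
    rw [show c + 2 * i + 2 + 2 * (k - i) = c + 2 * k + 2 by omega]
    exact hne
  funext x
  simp only [fwdDiff, Pi.sub_apply, Pi.smul_apply, nab2, smul_eq_mul]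
  rw [show c + 2 * i + 2 = (c + 2 * i) + 2 by ring]
  exact levelStep_shellLaw hπ hπ' hS H t (c + 2 * i) hne' x

omit hπ hπ' in
/-- The deletion-sum profile is the signed sum of the deleted shell-law profiles.
[cite: Rothvoss2017, §2 (PDF p. 6)] -/
theorem delStepLaw_profile_eq (S H : Finset (Fin n)) (t : ℕ) :
    (fun c' x => delStepLaw π S H t c' x : Profile) =
      (∑ v ∈ vAA π S H, ∑ w ∈ vDD π S H, (fun c' x => shellLaw π (del2 π S v w) H t c' x : Profile)) -
        ∑ v ∈ vBH π S H, ∑ w ∈ (vBN π S H).erase (π v), (fun c' x => shellLaw π (del2 π S v w) H t c' x : Profile) := by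
  funext c' x
  simp only [delStepLaw, Pi.sub_apply, Finset.sum_apply]

/-- **THE ITERATED `ℓ¹` BOUND.** For every `k, j`, every `π`-stable ground set `S`, every level `c`
with `Shell_S(t+2k, c+2k) ≠ ∅`, every finite window `X ⊆ ℤ`, every `ρ, B ≥ 0`: if
(i) every `π`-stable `S′ ⊆ S` with `|S′| > |S| − 4k` has `|AA(S′)|·|DD(S′)| + |BH(S′)|·|BN(S′)| ≤ ρ·|S′|(|S′|−2)`, and
(ii) every `π`-stable `S′ ⊆ S` with `|S′| = |S| − 4k` has `Σ_{x∈X} |(∇²)^{j+k}[law_{S′}(t,·)](c)(x)| ≤ B`,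
then `Σ_{x∈X} |(∇²)^j Δ^k_{(2)} [law_S(t+2k,·)](c)(x)| ≤ ρ^k · B`.
(Induction on `k`: one level step `levelStep_shellLaw`, the triangle inequality over the `AD` and `BB′`
deletion classes, `|S∖2e| = |S| − 4`, nonemptiness by `shellIn_del2_nonempty`.)
[cite: Rothvoss2017, §2 (PDF p. 6)] [cite: RollinRoss2010, §3 (Lemma 3.1: the `ℓ¹` smoothness functional)] -/
theorem sum_abs_nab2_iter_fwdDiff_iter_le (H : Finset (Fin n)) (t : ℕ) (X : Finset ℤ) {ρ B : ℝ}
    (hρ0 : 0 ≤ ρ) (hB0 : 0 ≤ B) :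
    ∀ (k j : ℕ) {S : Finset (Fin n)}, (∀ v ∈ S, π v ∈ S) → ∀ (c : ℕ),
      (shellIn π S (t + 2 * k) (c + 2 * k)).Nonempty →
      (∀ S' ⊆ S, (∀ v ∈ S', π v ∈ S') → S.card < S'.card + 4 * k →
        ((vAA π S' H).card : ℝ) * (vDD π S' H).card + ((vBH π S' H).card : ℝ) * (vBN π S' H).card ≤
          ρ * ((S'.card : ℝ) * ((S'.card : ℝ) - 2))) →
      (∀ S' ⊆ S, (∀ v ∈ S', π v ∈ S') → S'.card + 4 * k = S.card →
        ∑ x ∈ X, |nab2^[j + k] (fun c' x => shellLaw π S' H t c' x : Profile) c x| ≤ B) →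
      ∑ x ∈ X, |nab2^[j] ((fwdDiff 2)^[k] (fun c' x => shellLaw π S H (t + 2 * k) c' x : Profile)) c x| ≤
        ρ ^ k * B := by
  intro k
  induction k with
  | zero =>
      intro j S hS c _ _ hB
      simpa using hB S (Subset.refl S) hS (by simp)
  | succ k ih =>
      intro j S hS c hne hρ hB
      -- sizes
      have hS4 : t + 2 * (k + 1) + (c + 2 * (k + 1)) ≤ S.card := by
        obtain ⟨U, hU⟩ := hne; exact add_le_of_mem_shellIn hπ hS hU
      have h4 : (4 : ℝ) ≤ S.card := by
        have : 4 ≤ S.card := by omega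
        exact_mod_cast this
      have hden : 0 < (S.card : ℝ) * ((S.card : ℝ) - 2) := mul_pos (by linarith) (by linarith)
      set κ : ℝ := 1 / ((S.card : ℝ) * ((S.card : ℝ) - 2)) with hκ
      have hκ0 : 0 < κ := div_pos one_pos hden
      -- Step A/B: `Δ^{k+1} law_S(T+2) (c) = Δ^k (−κ • ∇² dsl_S(T)) (c)`, `T = t + 2k`
      set T := t + 2 * k with hT
      have hTop : t + 2 * (k + 1) = T + 2 := by rw [hT]; ring
      have hne' : (shellIn π S (T + 2) (c + 2 * k + 2)).Nonempty := by
        rw [← hTop, show c + 2 * k + 2 = c + 2 * (k + 1) by ring]; exact hne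
      have hstep : (fwdDiff 2)^[k + 1] (fun c' x => shellLaw π S H (t + 2 * (k + 1)) c' x : Profile) c =
          (fwdDiff 2)^[k] (-κ • nab2 (fun c' x => delStepLaw π S H T c' x : Profile)) c := by
        rw [Function.iterate_succ_apply]
        refine fwdDiff_iter_apply_congr k fun i hi => ?_
        rw [hTop]
        exact fwdDiff_shellLaw_eq hπ hπ' hS H T c k hne' i hi
      -- Step C/D/E: push `(∇²)^j` through and expand the deletion sum
      have hcomm : (fwdDiff 2)^[k] (nab2 (fun c' x => delStepLaw π S H T c' x : Profile)) =
          nab2 ((fwdDiff 2)^[k] (fun c' x => delStepLaw π S H T c' x : Profile)) := by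
        have := nab2_iter_fwdDiff_iter 1 k (fun c' x => delStepLaw π S H T c' x : Profile)
        simpa using this.symm
      have hop : nab2^[j] ((fwdDiff 2)^[k] (-κ • nab2 (fun c' x => delStepLaw π S H T c' x : Profile))) =
          -κ • ((∑ v ∈ vAA π S H, ∑ w ∈ vDD π S H,
              nab2^[j + 1] ((fwdDiff 2)^[k] (fun c' x => shellLaw π (del2 π S v w) H T c' x : Profile))) -
            ∑ v ∈ vBH π S H, ∑ w ∈ (vBN π S H).erase (π v),
              nab2^[j + 1] ((fwdDiff 2)^[k] (fun c' x => shellLaw π (del2 π S v w) H T c' x : Profile))) := by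
        rw [fwdDiff_iter_smul', nab2_iterate_smul, hcomm, ← Function.iterate_succ_apply nab2 j,
          delStepLaw_profile_eq, fwdDiff_iter_sub', nab2_iterate_sub]
        simp only [fwdDiff_iter_sum', nab2_iterate_sum]
      have hexp : nab2^[j] ((fwdDiff 2)^[k + 1] (fun c' x => shellLaw π S H (t + 2 * (k + 1)) c' x : Profile)) c =
          (-κ • ((∑ v ∈ vAA π S H, ∑ w ∈ vDD π S H,
              nab2^[j + 1] ((fwdDiff 2)^[k] (fun c' x => shellLaw π (del2 π S v w) H T c' x : Profile))) -
            ∑ v ∈ vBH π S H, ∑ w ∈ (vBN π S H).erase (π v),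
              nab2^[j + 1] ((fwdDiff 2)^[k] (fun c' x => shellLaw π (del2 π S v w) H T c' x : Profile)))) c := by
        rw [nab2_iter_apply_congr j hstep, hop]
      -- Step F: triangle inequality and the induction hypothesis on each deleted ground set
      have hIH : ∀ v ∈ S, ∀ w ∈ S, w ≠ v → w ≠ π v →
          ∑ x ∈ X, |nab2^[j + 1] ((fwdDiff 2)^[k] (fun c' x => shellLaw π (del2 π S v w) H T c' x : Profile)) c x| ≤
            ρ ^ k * B := by
        intro v hv w hw hwv hwπ
        have hst := del2_stable hπ hS v w
        have hsub : del2 π S v w ⊆ S := sdiff_subset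
        have hcard : (del2 π S v w).card + 4 = S.card := by
          have := card_del2_add_four hπ hπ' hS hv hw hwv hwπ
          omega
        have hne2 : (shellIn π (del2 π S v w) (t + 2 * k) (c + 2 * k)).Nonempty := by
          refine shellIn_del2_nonempty hπ hπ' hS ?_ hv hw hwv hwπ
          rw [show t + 2 * k + 2 = t + 2 * (k + 1) by ring, show c + 2 * k + 2 = c + 2 * (k + 1) by ring]
          exact hne
        refine ih (j + 1) hst c hne2 ?_ ?_
        · intro S' hS' hst' hlt
          exact hρ S' (hS'.trans hsub) hst' (by omega)
        · intro S' hS' hst' heq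
          rw [show j + 1 + k = j + (k + 1) by ring]
          exact hB S' (hS'.trans hsub) hst' (by omega)
      have hAD : ∑ v ∈ vAA π S H, ∑ w ∈ vDD π S H,
          ∑ x ∈ X, |nab2^[j + 1] ((fwdDiff 2)^[k] (fun c' x => shellLaw π (del2 π S v w) H T c' x : Profile)) c x| ≤
            ((vAA π S H).card : ℝ) * (vDD π S H).card * (ρ ^ k * B) := by
        calc _ ≤ ∑ v ∈ vAA π S H, ∑ w ∈ vDD π S H, ρ ^ k * B := by
              refine sum_le_sum fun v hv => sum_le_sum fun w hw => ?_
              obtain ⟨hvS, hvH, hπvH⟩ := mem_vAA.1 hv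
              obtain ⟨hwS, hwH, _⟩ := mem_vDD.1 hw
              exact hIH v hvS w hwS (fun e => hwH (e ▸ hvH)) (fun e => hwH (e ▸ hπvH))
          _ = _ := by rw [sum_const, sum_const, nsmul_eq_mul, nsmul_eq_mul]; ring
      have hBB : ∑ v ∈ vBH π S H, ∑ w ∈ (vBN π S H).erase (π v),
          ∑ x ∈ X, |nab2^[j + 1] ((fwdDiff 2)^[k] (fun c' x => shellLaw π (del2 π S v w) H T c' x : Profile)) c x| ≤
            ((vBH π S H).card : ℝ) * (vBN π S H).card * (ρ ^ k * B) := by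
        calc _ ≤ ∑ v ∈ vBH π S H, ∑ w ∈ (vBN π S H).erase (π v), ρ ^ k * B := by
              refine sum_le_sum fun v hv => sum_le_sum fun w hw => ?_
              obtain ⟨hvS, hvH, _⟩ := mem_vBH.1 hv
              obtain ⟨hwπv, hw'⟩ := mem_erase.1 hw
              obtain ⟨hwS, hwH, _⟩ := mem_vBN.1 hw'
              exact hIH v hvS w hwS (fun e => hwH (e ▸ hvH)) hwπv
          _ ≤ ∑ v ∈ vBH π S H, ∑ w ∈ vBN π S H, ρ ^ k * B :=
              sum_le_sum fun v _ => sum_le_sum_of_subset_of_nonneg (erase_subset _ _) fun w _ _ => by positivity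
          _ = _ := by rw [sum_const, sum_const, nsmul_eq_mul, nsmul_eq_mul]; ring
      have hpairs := hρ S (Subset.refl S) hS (by omega)
      -- pointwise triangle inequality, then sum over the window
      rw [hexp]
      calc ∑ x ∈ X, |(-κ • ((∑ v ∈ vAA π S H, ∑ w ∈ vDD π S H,
              nab2^[j + 1] ((fwdDiff 2)^[k] (fun c' x => shellLaw π (del2 π S v w) H T c' x : Profile))) -
            ∑ v ∈ vBH π S H, ∑ w ∈ (vBN π S H).erase (π v),
              nab2^[j + 1] ((fwdDiff 2)^[k] (fun c' x => shellLaw π (del2 π S v w) H T c' x : Profile)))) c x|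
          ≤ ∑ x ∈ X, κ * ((∑ v ∈ vAA π S H, ∑ w ∈ vDD π S H,
              |nab2^[j + 1] ((fwdDiff 2)^[k] (fun c' x => shellLaw π (del2 π S v w) H T c' x : Profile)) c x|) +
            ∑ v ∈ vBH π S H, ∑ w ∈ (vBN π S H).erase (π v),
              |nab2^[j + 1] ((fwdDiff 2)^[k] (fun c' x => shellLaw π (del2 π S v w) H T c' x : Profile)) c x|) := by
            refine sum_le_sum fun x _ => ?_
            simp only [Pi.smul_apply, Pi.sub_apply, Finset.sum_apply, smul_eq_mul, abs_mul, abs_neg, abs_of_pos hκ0]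
            refine mul_le_mul_of_nonneg_left ?_ hκ0.le
            refine (abs_sub _ _).trans (add_le_add ?_ ?_)
            · exact (abs_sum_le_sum_abs _ _).trans (sum_le_sum fun v _ => abs_sum_le_sum_abs _ _)
            · exact (abs_sum_le_sum_abs _ _).trans (sum_le_sum fun v _ => abs_sum_le_sum_abs _ _)
        _ = κ * ((∑ v ∈ vAA π S H, ∑ w ∈ vDD π S H,
              ∑ x ∈ X, |nab2^[j + 1] ((fwdDiff 2)^[k] (fun c' x => shellLaw π (del2 π S v w) H T c' x : Profile)) c x|) +
            ∑ v ∈ vBH π S H, ∑ w ∈ (vBN π S H).erase (π v),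
              ∑ x ∈ X, |nab2^[j + 1] ((fwdDiff 2)^[k] (fun c' x => shellLaw π (del2 π S v w) H T c' x : Profile)) c x|) := by
            rw [← mul_sum, sum_add_distrib]
            congr 2
            · rw [sum_comm]; exact sum_congr rfl fun v _ => sum_comm
            · rw [sum_comm]; exact sum_congr rfl fun v _ => sum_comm
        _ ≤ κ * ((((vAA π S H).card : ℝ) * (vDD π S H).card + ((vBH π S H).card : ℝ) * (vBN π S H).card) * (ρ ^ k * B)) := by
            refine mul_le_mul_of_nonneg_left ?_ hκ0.le
            calc _ ≤ ((vAA π S H).card : ℝ) * (vDD π S H).card * (ρ ^ k * B) +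
                  ((vBH π S H).card : ℝ) * (vBN π S H).card * (ρ ^ k * B) := add_le_add hAD hBB
              _ = _ := by ring
        _ ≤ κ * ((ρ * ((S.card : ℝ) * ((S.card : ℝ) - 2))) * (ρ ^ k * B)) := by
            refine mul_le_mul_of_nonneg_left (mul_le_mul_of_nonneg_right hpairs (by positivity)) hκ0.le
        _ = ρ ^ (k + 1) * B := by
            have hS0 : (S.card : ℝ) ≠ 0 := ne_of_gt (by linarith)
            have hS2 : (S.card : ℝ) - 2 ≠ 0 := ne_of_gt (by linarith)
            rw [hκ, pow_succ, div_mul_eq_mul_div, one_mul, div_eq_iff (mul_ne_zero hS0 hS2)]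
            ring

end Iterated

/-! ### §4 The universal deletion-pair bound `|AA||DD| + |BH||BN| ≤ |S|²/4 ≤ (m/(4(m−2)))·|S|(|S|−2)` -/

section Pairs

variable (hπ : ∀ v, π (π v) = v)
include hπ

/-- `π` maps the `H`-endpoints of the mixed edges bijectively onto their non-`H` endpoints.
[cite: Rothvoss2017, §2 (PDF p. 5)] -/
theorem card_vBH_eq_card_vBN {S : Finset (Fin n)} (hS : ∀ v ∈ S, π v ∈ S) (H : Finset (Fin n)) :
    (vBH π S H).card = (vBN π S H).card := by
  have himg : (vBH π S H).image π = vBN π S H := by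
    ext w
    simp only [mem_image, mem_vBH, mem_vBN]
    constructor
    · rintro ⟨v, ⟨hvS, hvH, hπv⟩, rfl⟩
      exact ⟨hS v hvS, hπv, by rw [hπ]; exact hvH⟩
    · rintro ⟨hwS, hwH, hπw⟩
      exact ⟨π w, ⟨hS w hwS, hπw, by rw [hπ]; exact hwH⟩, hπ w⟩
  rw [← himg, card_image_of_injective _ fun a b h => by rw [← hπ a, h, hπ]]

omit hπ in
/-- The four type classes partition the ground set. [cite: Rothvoss2017, §2 (PDF p. 5)] -/
theorem card_types_eq (S H : Finset (Fin n)) :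
    (vAA π S H).card + (vBH π S H).card + ((vBN π S H).card + (vDD π S H).card) = S.card := by
  have h1 := card_filter_add_card_filter_not (s := S) (fun v => v ∈ H)
  have h2 := card_filter_add_card_filter_not (s := S.filter fun v => v ∈ H) (fun v => π v ∈ H)
  have h3 := card_filter_add_card_filter_not (s := S.filter fun v => v ∉ H) (fun v => π v ∈ H)
  simp only [filter_filter] at h2 h3
  have eAA : (S.filter fun v => v ∈ H ∧ π v ∈ H) = vAA π S H := rfl
  have eBH : (S.filter fun v => v ∈ H ∧ ¬π v ∈ H) = vBH π S H := rfl
  have eBN : (S.filter fun v => v ∉ H ∧ π v ∈ H) = vBN π S H := rfl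
  have eDD : (S.filter fun v => v ∉ H ∧ ¬π v ∈ H) = vDD π S H := rfl
  rw [eAA, eBH] at h2
  rw [eBN, eDD] at h3
  omega

/-- **The deletion-pair count is at most `|S|²/4`**: `|AA|·|DD| + |BH|·|BN| ≤ |S|²/4`
(`4ad + b² ≤ (a+b+d)²` for a matching of `H`-type `(a,b,d)`). [cite: Rothvoss2017, §2 (PDF p. 6)] -/
theorem pairs_le_card_sq {S : Finset (Fin n)} (hS : ∀ v ∈ S, π v ∈ S) (H : Finset (Fin n)) :
    ((vAA π S H).card : ℝ) * (vDD π S H).card + ((vBH π S H).card : ℝ) * (vBN π S H).card ≤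
      (S.card : ℝ) ^ 2 / 4 := by
  have hb := card_vBH_eq_card_vBN hπ hS H
  have hsum := card_types_eq (π := π) S H
  set A := ((vAA π S H).card : ℝ)
  set D := ((vDD π S H).card : ℝ)
  set b := ((vBH π S H).card : ℝ)
  have hb' : ((vBN π S H).card : ℝ) = b := by
    have : ((vBN π S H).card : ℝ) = ((vBH π S H).card : ℝ) := by exact_mod_cast hb.symm
    exact this
  have hS' : (S.card : ℝ) = A + b + (b + D) := by
    have : (S.card : ℝ) = ((vAA π S H).card : ℝ) + (vBH π S H).card + (((vBN π S H).card : ℝ) + (vDD π S H).card) := by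
      exact_mod_cast hsum.symm
    rw [this, hb']
  rw [hb', hS']
  nlinarith [sq_nonneg (A - D), sq_nonneg b, mul_nonneg (show (0:ℝ) ≤ b by positivity)
    (show (0:ℝ) ≤ A + D by positivity)]

/-- **The `ρ`-hypothesis of the iterated bound holds with `ρ = m/(4(m−2))`** for every `π`-stable
ground set of size `≥ m ≥ 3`: `|AA|·|DD| + |BH|·|BN| ≤ (m/(4(m−2)))·|S|(|S|−2)`.
[cite: Rothvoss2017, §2 (PDF p. 6)] -/
theorem pairs_le_rho {S : Finset (Fin n)} (hS : ∀ v ∈ S, π v ∈ S) (H : Finset (Fin n)) {m : ℕ}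
    (hm : 3 ≤ m) (hmS : m ≤ S.card) :
    ((vAA π S H).card : ℝ) * (vDD π S H).card + ((vBH π S H).card : ℝ) * (vBN π S H).card ≤
      ((m : ℝ) / (4 * ((m : ℝ) - 2))) * ((S.card : ℝ) * ((S.card : ℝ) - 2)) := by
  refine (pairs_le_card_sq hπ hS H).trans ?_
  have hm' : (3 : ℝ) ≤ m := by exact_mod_cast hm
  have hmS' : (m : ℝ) ≤ S.card := by exact_mod_cast hmS
  have hm2 : (0 : ℝ) < (m : ℝ) - 2 := by linarith
  rw [div_mul_eq_mul_div, le_div_iff₀ (by linarith), div_mul_eq_mul_div, div_le_iff₀ (by norm_num : (0:ℝ) < 4)]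
  nlinarith

end Pairs

/-! ### §5 The shell average of a block statistic is the pairing of its profile with the shell law -/

section Univ

omit π in
/-- Inside the full ground set the relative shells are the shells. [cite: Rothvoss2017, §2 (PDF p. 6)] -/
theorem shellIn_univ (π : Fin n → Fin n) (t c : ℕ) : shellIn π univ t c = shell π t c := by
  ext U; simp [shellIn, shell]

/-- **`E_{Shell_c}[ψ(|U ∩ H|)] = Σ_{x=0}^{t} ψ(x) · law(t,c;x)`** (ground set `univ`; both sides `0` for an
empty shell). [cite: Rothvoss2017, §2 (PDF p. 6)] -/
theorem shellAvg_eq_sum_mul_shellLaw (H : Finset (Fin n)) (t c : ℕ) (ψ : ℤ → ℝ) :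
    (∑ U ∈ shell π t c, ψ ((U ∩ H).card : ℤ)) / ((shell π t c).card : ℝ) =
      ∑ x ∈ Icc (0 : ℤ) t, ψ x * shellLaw π univ H t c x := by
  have hmaps : ∀ U ∈ shell π t c, ((U ∩ H).card : ℤ) ∈ Icc (0 : ℤ) t := by
    intro U hU
    rw [mem_Icc]
    refine ⟨by positivity, ?_⟩
    have h1 : (U ∩ H).card ≤ U.card := card_le_card inter_subset_left
    have h2 : U.card = t := by
      rw [← shellIn_univ] at hU; exact (mem_shellIn.1 hU).2.1
    exact_mod_cast h2 ▸ h1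
  rw [← sum_fiberwise_of_maps_to hmaps, sum_div]
  refine sum_congr rfl fun x _ => ?_
  rw [shellLaw, shellCount, shellIn_univ]
  have : ∑ U ∈ (shell π t c).filter (fun U => ((U ∩ H).card : ℤ) = x), ψ ((U ∩ H).card : ℤ) =
      ψ x * (((shell π t c).filter fun U => ((U ∩ H).card : ℤ) = x).card : ℝ) := by
    rw [mul_comm, ← nsmul_eq_mul, ← sum_const]
    refine sum_congr rfl fun U hU => ?_
    rw [(mem_filter.1 hU).2]
  rw [this, mul_div_assoc]

/-- **Level differences of the shell profile of a block statistic**: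
`Δ^k_{(2)}[c ↦ E_{Shell_c}[ψ(|U∩H|)]](c) = Σ_x ψ(x) · Δ^k_{(2)}[law(t,·;x)](c)`.
[cite: Rothvoss2017, §2 (PDF p. 6)] -/
theorem fwdDiff_iter_shellAvg_eq (H : Finset (Fin n)) (t k c : ℕ) (ψ : ℤ → ℝ) :
    (fwdDiff 2)^[k] (fun c => (∑ U ∈ shell π t c, ψ ((U ∩ H).card : ℤ)) / ((shell π t c).card : ℝ)) c =
      ∑ x ∈ Icc (0 : ℤ) t, ψ x * (fwdDiff 2)^[k] (fun c' x => shellLaw π univ H t c' x : Profile) c x := by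
  have hfun : (fun c => (∑ U ∈ shell π t c, ψ ((U ∩ H).card : ℤ)) / ((shell π t c).card : ℝ)) =
      fun c => ∑ x ∈ Icc (0 : ℤ) t, ψ x * shellLaw π univ H t c x := by
    funext c; exact shellAvg_eq_sum_mul_shellLaw H t c ψ
  rw [hfun, fwdDiff_iter_eq_sum_shift]
  have hP : ∀ x : ℤ, (fwdDiff 2)^[k] (fun c' x => shellLaw π univ H t c' x : Profile) c x =
      ∑ i ∈ range (k + 1), ((-1 : ℤ) ^ (k - i) * (k.choose i : ℤ)) • shellLaw π univ H t (c + i • 2) x := by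
    intro x
    rw [fwdDiff_iter_eq_sum_shift]
    simp only [Finset.sum_apply, Pi.smul_apply]
  simp only [hP, mul_sum, smul_eq_mul, zsmul_eq_mul]
  rw [sum_comm]
  refine sum_congr rfl fun i _ => sum_congr rfl fun x _ => ?_
  push_cast
  ring

/-- **`ℓ¹` control of the level differences of a block-statistic profile**: if `|ψ| ≤ G` on `[0,t]` then
`|Δ^k_{(2)}[c ↦ E_{Shell_c}[ψ(|U∩H|)]](c)| ≤ G · Σ_{x=0}^{t} |Δ^k_{(2)}[law(t,·;x)](c)|`.
[cite: RollinRoss2010, §3 (Lemma 3.1: duality of the `ℓ¹` smoothness functional)] -/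
theorem abs_fwdDiff_iter_shellAvg_le (H : Finset (Fin n)) (t k c : ℕ) (ψ : ℤ → ℝ) {G : ℝ}
    (hG : ∀ x ∈ Icc (0 : ℤ) t, |ψ x| ≤ G) :
    |(fwdDiff 2)^[k] (fun c => (∑ U ∈ shell π t c, ψ ((U ∩ H).card : ℤ)) / ((shell π t c).card : ℝ)) c| ≤
      G * ∑ x ∈ Icc (0 : ℤ) t, |(fwdDiff 2)^[k] (fun c' x => shellLaw π univ H t c' x : Profile) c x| := by
  rw [fwdDiff_iter_shellAvg_eq, mul_sum]
  refine (abs_sum_le_sum_abs _ _).trans (sum_le_sum fun x hx => ?_)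
  rw [abs_mul]
  exact mul_le_mul_of_nonneg_right (hG x hx) (abs_nonneg _)

end Univ

end ShellStep

end Literature.Combinatorics.Optimization

end
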